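import Literature.MathematicalPhysics.QuantumFieldTheory.Balaban1983to89.B5DeltaA169
import Literature.MathematicalPhysics.QuantumFieldTheory.Balaban1983to89.B5DivOrth
import HarnessLib

/-!
# NE7StraightSliceB5Gauge — row NE7 (node U5), the (A)-bill's XL(c) docking, file D5 (iv)+(v) of `t4/b2b-balaban-t4-ne7-p2/g84/XLC-DOCKING-MEMO.md` §7 ∕ route risk #4:
# BAŁABAN's OWN GAUGE `λ₀` OF (1.25) PUTS EVERY `ker Q_k` FIELD INTO THE `R∂*`-GAUGE INSIDE `ker Q_k`; THERE THE CURL-ONLY CONSTRAINED WEAK EQUATION IS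
# `Δ_a`'s ((1.69)); BY POSITIVITY OF `Δ_a` THE CONSTRAINED WEAK SOLUTION IS UNIQUE — SO THE CURL OF ANY CURL-ONLY WEAK SOLUTION IS THE CURL OF `Δ_a`'s

Lineage `b2b-balaban-t4-ne7-p2` (CRUX PROVER NE7 #2, co-owner of row NE7), generation 84.  A module ENTIRELY IN lit-balaban's SYMBOLS (no T4 object): over
`B5Action121` (`GradOp = ∂`, `CurlOp`, `Fs_gaugeT`, `gaugeT A λ = A − ∂λ`, `GradOp_conjTranspose_mul_GradOp : ∂ᴴ∂ = Δ`), `B5Block118` (`QvOp = Q_k`, (1.20) `QvOp_gaugeT_eq`),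
`B5Value126` (Bałaban's `λ₀` of (1.25): `lambda0`, `QsOp_lambda0 : Q′_kλ₀ = 0`, `residual_lambda0 : ∂*A − Δλ₀ = P∂*A`, `PcT_mulVec_idem : P² = P`), `B5DivOrth`
(`sum_GradOp_adjoint : ∂*A ⊥ 1`), `B5DeltaA169` (`DeltaA = Δ_a`, (1.69) `DeltaA_eq_curl : Δ_a = ½∂ᴴ∂ + ∂(I − P)∂ᴴ + aQ*Q`, `DeltaA_posDef`).
WHAT ([folklore] linear algebra on Bałaban's typed operators; [cite: Balaban1984PropagatorsI, (1.20) p.20, (1.25)–(1.26) p.22, (1.69)–(1.70) pp.29–30]).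
§1 `CurlOp_mulVec_gaugeT` (`∂(A − ∂λ) = ∂A` as plaquette functions), `div_gaugeT` (`∂ᴴ(A − ∂λ) = ∂ᴴA − Δλ`), `QvOp_gaugeT_lambda0` (`Q_k(A − ∂λ₀(b)) = Q_kA`: (1.20) with `Q′_kλ₀ = 0`).
§2 **`R_div_gaugeT_lambda0`**: for EVERY vector function `A` on `T_η`, Bałaban's representative `A′ := A − ∂λ₀(∂ᴴA)` satisfies `(I − P)∂ᴴA′ = 0` (`R∂*A′ = 0`, `R = I − P` of (1.69));
**`DeltaA_mulVec_of_gauge`**: if `Q_kA = 0` and `(I − P)∂ᴴA = 0` then `Δ_a A = ½∂ᴴ(∂A)` — the gauge term AND the penalty of (1.69) drop; `form_DeltaA_of_gauge` (`⟨β, Δ_aA⟩ = ½⟨∂β, ∂A⟩`).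
§3 **`weak_DeltaA_gaugeT_lambda0`**: if `α ∈ ker Q_k` solves the CURL-ONLY constrained weak equation `∀ β ∈ ker Q_k, ½⟨∂β, ∂α⟩ = ⟨β, J⟩`, then `α′ ∈ ker Q_k`, `∂α′ = ∂α`, and
`α′` solves `Δ_a`'s constrained weak equation `∀ β ∈ ker Q_k, ⟨β, Δ_a α′⟩ = ⟨β, J⟩`; `exists_gauged_weak_DeltaA` (packaged).
§4 **`eq_of_weak_DeltaA`** (`1 ≤ n`, `0 < a`): two fields of `ker Q_k` solving `Δ_a`'s constrained weak equation with the same `J` are EQUAL (`DeltaA_posDef`, test `β = A₁ − A₂`);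
**`CurlOp_eq_of_weak_curl_of_weak_DeltaA`** — THE DOCKING: `∂α = ∂A` whenever `α ∈ ker Q_k` solves the curl-only equation and `A ∈ ker Q_k` solves `Δ_a`'s, same `J`
(the `A` to use is the constrained Green field `GJ − GQ*(QGQ*)⁻¹QGJ` of (140) `NE7ConstrainedGreenIdentity`, whose gradients lit-balaban's (1.115)₂ bounds — step (vi), the OWNER's).
§5 `CurlOp_mulVec_eq_smul` (`CurlOp c = c × CurlOp 1` on vectors), `curlForm_eq_mul` ∕ `curlForm_natCast` (the curl form at `c = n` is `n²` × the form at `c = 1`, where (145) reads the T4 Hessian).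
§6 `weak_curl_of_imaginary_tests`: the curl-only equation for all `β ∈ ker Q_k` follows from it for the purely imaginary `β ∈ ker Q_k` (the transfers `toB5 ζ` of SKEW T4 test fields, (143)).
So route risk #4 of the memo («the gauge term ⟨∂*B, R∂*A⟩ must drop») is SETTLED by Bałaban's own (1.25): no audit gap is touched (only criticality of `λ₀`, typed in `B5Value126`, is used —
not the infimum (1.24), not the Faddeev–Popov passage G-B5-01).
HONEST FRAMING (page 1): [folklore] linear algebra; NO estimate (the letter is (vi)); nothing of Bałaban's asserted beyond lit-balaban's typed (1.20)∕(1.25)∕(1.26)∕(1.69); NOT (APE),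
NOT ONE-STEP, NOT NE7; spine 0∕9; finite T⁴ rung (B)+1 — NOT infinite volume, NOT mass gap, NOT Clay.  Continuum YM on T⁴ ⇐ BetaPertH ∧ nine spine estimates (0/9 proved);
BetaPertH ⇐ (D1) ∧ (D4) ∧ CAP+tail; G-an2-4 gates asym, D1 and NE2/3/4.
-/

set_option autoImplicit false

open scoped BigOperators Matrix ComplexConjugate ComplexOrder
open Finset

namespace Summit.QuantumFields.BalabanUV.T4Continuum.NE7StraightSliceB5Gauge

open Literature.MathematicalPhysics.QuantumFieldTheory.Balaban1983to89
open B5Prop11Plancherel (Tor fine)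
open B5Action121 (GradOp CurlOp Fs gaugeT LapS CurlOp_mulVec Fs_gaugeT GradOp_conjTranspose_mul_GradOp star_mulVec_dotProduct Fs_apply)
open B5Block118 (QvOp QsOp QvOp_gaugeT_eq QvOp_mulVec)
open B5Value126 (PcT lambda0 QsOp_lambda0 residual_lambda0 PcT_mulVec_idem)
open B5DivOrth (sum_GradOp_adjoint)
open B5DeltaA169 (DeltaA DeltaA_eq_curl DeltaA_posDef)

noncomputable section

variable {d : ℕ}

/-! ## §1 Gauge transformations: the curl is unchanged, the divergence moves by `Δλ`, `Q_k` by `∂Q′_kλ` -/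

/-- `∂(A − ∂λ) = ∂A` as plaquette functions (ordered pairs). [cite: Balaban1984PropagatorsI, (1.4) p.18] -/
theorem CurlOp_mulVec_gaugeT (N : Fin d → ℕ) [∀ μ, NeZero (N μ)] (c : ℂ) (A : Tor N × Fin d → ℂ) (l : Tor N → ℂ) :
    CurlOp N c *ᵥ gaugeT N c A l = CurlOp N c *ᵥ A := by
  funext i
  obtain ⟨x, μ, ν⟩ := i
  rw [CurlOp_mulVec, CurlOp_mulVec, Fs_gaugeT]

/-- `∂ᴴ(A − ∂λ) = ∂ᴴA − Δλ` (`∂ᴴ∂ = Δ` on scalar functions). [folklore] -/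
theorem div_gaugeT (N : Fin d → ℕ) [∀ μ, NeZero (N μ)] (c : ℂ) (A : Tor N × Fin d → ℂ) (l : Tor N → ℂ) :
    (GradOp N c)ᴴ *ᵥ gaugeT N c A l = (GradOp N c)ᴴ *ᵥ A - LapS N c *ᵥ l := by
  rw [gaugeT, Matrix.mulVec_sub, Matrix.mulVec_mulVec, GradOp_conjTranspose_mul_GradOp]

variable (n : ℕ) [NeZero n] (M : Fin d → ℕ) [hM : ∀ μ, NeZero (M μ)]

/-- `Q_k(A − ∂λ₀(b)) = Q_kA` for Bałaban's `λ₀` of (1.25) (every `b`): (1.20) `Q_kA^λ = Q_kA − ∂Q′_kλ` with (1.25)₂ `Q′_kλ₀ = 0`.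
[cite: Balaban1984PropagatorsI, (1.20) p.20, (1.25) p.22] -/
theorem QvOp_gaugeT_lambda0 (A : Tor (fine n M) × Fin d → ℂ) (b : Tor (fine n M) → ℂ) :
    QvOp n M *ᵥ gaugeT (fine n M) (n : ℂ) A (lambda0 n M (n : ℂ) b) = QvOp n M *ᵥ A := by
  have hn0 : (n : ℂ) ≠ 0 := Nat.cast_ne_zero.mpr (NeZero.ne n)
  rw [QvOp_gaugeT_eq, QsOp_lambda0 n M (n : ℂ) hn0 b, Matrix.mulVec_zero, sub_zero]

/-! ## §2 Bałaban's representative `A − ∂λ₀(∂ᴴA)` is in the `R∂*`-gauge; there `Δ_a = ½∂ᴴ∂` on `ker Q_k` -/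

/-- **`R∂*A′ = 0` FOR BAŁABAN's REPRESENTATIVE** `A′ := A − ∂λ₀(∂ᴴA)` of ANY vector function `A` on `T_η` (`R = I − P`, `P` of (1.70) = `B5Value126.PcT`):
`∂ᴴA′ = ∂ᴴA − Δλ₀(∂ᴴA) = P∂ᴴA` ((1.26), `∂ᴴA ⊥ 1`) and `P² = P`. [cite: Balaban1984PropagatorsI, (1.26) p.22, (1.69)–(1.70) pp.29–30] -/
theorem R_div_gaugeT_lambda0 (A : Tor (fine n M) × Fin d → ℂ) :
    (1 - PcT n M (n : ℂ)) *ᵥ ((GradOp (fine n M) (n : ℂ))ᴴ *ᵥ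
        gaugeT (fine n M) (n : ℂ) A (lambda0 n M (n : ℂ) ((GradOp (fine n M) (n : ℂ))ᴴ *ᵥ A))) = 0 := by
  have hn0 : (n : ℂ) ≠ 0 := Nat.cast_ne_zero.mpr (NeZero.ne n)
  rw [div_gaugeT, residual_lambda0 n M (n : ℂ) hn0 _ (sum_GradOp_adjoint (fine n M) (n : ℂ) A), Matrix.sub_mulVec, Matrix.one_mulVec,
    PcT_mulVec_idem n M (n : ℂ) hn0, sub_self]

/-- **ON `ker Q_k` IN THE `R∂*`-GAUGE, `Δ_a A = ½∂ᴴ(∂A)`**: the gauge term `∂(I − P)∂ᴴA` and the penalty `aQ*QA` of (1.69) vanish. [cite: Balaban1984PropagatorsI, (1.69) p.29] -/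
theorem DeltaA_mulVec_of_gauge (a : ℝ) {A : Tor (fine n M) × Fin d → ℂ} (hQ : QvOp n M *ᵥ A = 0)
    (hR : (1 - PcT n M (n : ℂ)) *ᵥ ((GradOp (fine n M) (n : ℂ))ᴴ *ᵥ A) = 0) :
    DeltaA n M a *ᵥ A = (1 / 2 : ℂ) • ((CurlOp (fine n M) (n : ℂ))ᴴ *ᵥ (CurlOp (fine n M) (n : ℂ) *ᵥ A)) := by
  rw [DeltaA_eq_curl]
  simp only [Matrix.add_mulVec, Matrix.smul_mulVec, ← Matrix.mulVec_mulVec, hR, hQ, Matrix.mulVec_zero, smul_zero, add_zero]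

/-- … hence `⟨β, Δ_aA⟩ = ½⟨∂β, ∂A⟩` for every `β`. [cite: Balaban1984PropagatorsI, (1.69) p.29] -/
theorem form_DeltaA_of_gauge (a : ℝ) {A : Tor (fine n M) × Fin d → ℂ} (hQ : QvOp n M *ᵥ A = 0)
    (hR : (1 - PcT n M (n : ℂ)) *ᵥ ((GradOp (fine n M) (n : ℂ))ᴴ *ᵥ A) = 0) (β : Tor (fine n M) × Fin d → ℂ) :
    star β ⬝ᵥ (DeltaA n M a *ᵥ A) = (1 / 2 : ℂ) * (star (CurlOp (fine n M) (n : ℂ) *ᵥ β) ⬝ᵥ (CurlOp (fine n M) (n : ℂ) *ᵥ A)) := by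
  rw [DeltaA_mulVec_of_gauge n M a hQ hR, dotProduct_smul, smul_eq_mul, star_mulVec_dotProduct]

/-! ## §3 The curl-only constrained weak equation becomes `Δ_a`'s after Bałaban's gauge -/

/-- **THE CURL-ONLY CONSTRAINED WEAK EQUATION BECOMES `Δ_a`'s IN BAŁABAN's GAUGE**: if `Q_kα = 0` and `½⟨∂β, ∂α⟩ = ⟨β, J⟩` for all `β ∈ ker Q_k`, then
`α′ := α − ∂λ₀(∂ᴴα)` has `Q_kα′ = 0`, `∂α′ = ∂α`, and `⟨β, Δ_a α′⟩ = ⟨β, J⟩` for all `β ∈ ker Q_k` (every `a`).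
[cite: Balaban1984PropagatorsI, (1.20) p.20, (1.25) p.22, (1.69) p.29] -/
theorem weak_DeltaA_gaugeT_lambda0 (a : ℝ) {α J : Tor (fine n M) × Fin d → ℂ} (hα : QvOp n M *ᵥ α = 0)
    (hw : ∀ β, QvOp n M *ᵥ β = 0 →
      (1 / 2 : ℂ) * (star (CurlOp (fine n M) (n : ℂ) *ᵥ β) ⬝ᵥ (CurlOp (fine n M) (n : ℂ) *ᵥ α)) = star β ⬝ᵥ J) :
    QvOp n M *ᵥ gaugeT (fine n M) (n : ℂ) α (lambda0 n M (n : ℂ) ((GradOp (fine n M) (n : ℂ))ᴴ *ᵥ α)) = 0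
      ∧ CurlOp (fine n M) (n : ℂ) *ᵥ gaugeT (fine n M) (n : ℂ) α (lambda0 n M (n : ℂ) ((GradOp (fine n M) (n : ℂ))ᴴ *ᵥ α))
          = CurlOp (fine n M) (n : ℂ) *ᵥ α
      ∧ ∀ β, QvOp n M *ᵥ β = 0 →
          star β ⬝ᵥ (DeltaA n M a *ᵥ gaugeT (fine n M) (n : ℂ) α (lambda0 n M (n : ℂ) ((GradOp (fine n M) (n : ℂ))ᴴ *ᵥ α))) = star β ⬝ᵥ J := by
  have hQ : QvOp n M *ᵥ gaugeT (fine n M) (n : ℂ) α (lambda0 n M (n : ℂ) ((GradOp (fine n M) (n : ℂ))ᴴ *ᵥ α)) = 0 := by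
    rw [QvOp_gaugeT_lambda0, hα]
  refine ⟨hQ, CurlOp_mulVec_gaugeT _ _ _ _, fun β hβ => ?_⟩
  rw [form_DeltaA_of_gauge n M a hQ (R_div_gaugeT_lambda0 n M α), CurlOp_mulVec_gaugeT, hw β hβ]

/-- Packaged: a curl-only constrained weak solution in `ker Q_k` has a gauge relative in `ker Q_k`, with the same curl, in the `R∂*`-gauge, solving `Δ_a`'s
constrained weak equation. [cite: Balaban1984PropagatorsI, (1.25) p.22, (1.69) p.29] -/
theorem exists_gauged_weak_DeltaA (a : ℝ) {α J : Tor (fine n M) × Fin d → ℂ} (hα : QvOp n M *ᵥ α = 0)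
    (hw : ∀ β, QvOp n M *ᵥ β = 0 →
      (1 / 2 : ℂ) * (star (CurlOp (fine n M) (n : ℂ) *ᵥ β) ⬝ᵥ (CurlOp (fine n M) (n : ℂ) *ᵥ α)) = star β ⬝ᵥ J) :
    ∃ α' : Tor (fine n M) × Fin d → ℂ, QvOp n M *ᵥ α' = 0 ∧ CurlOp (fine n M) (n : ℂ) *ᵥ α' = CurlOp (fine n M) (n : ℂ) *ᵥ α
      ∧ (1 - PcT n M (n : ℂ)) *ᵥ ((GradOp (fine n M) (n : ℂ))ᴴ *ᵥ α') = 0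
      ∧ ∀ β, QvOp n M *ᵥ β = 0 → star β ⬝ᵥ (DeltaA n M a *ᵥ α') = star β ⬝ᵥ J := by
  obtain ⟨hQ, hC, hW⟩ := weak_DeltaA_gaugeT_lambda0 n M a hα hw
  exact ⟨_, hQ, hC, R_div_gaugeT_lambda0 n M α, hW⟩

/-! ## §4 Uniqueness by positivity of `Δ_a`; the docking `∂α = ∂A` -/

/-- **UNIQUENESS OF THE CONSTRAINED WEAK SOLUTION**: two fields of `ker Q_k` solving `Δ_a`'s constrained weak equation with the same source are equal (`Δ_a > 0`, test `A₁ − A₂`).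
[cite: Balaban1984PropagatorsI, p.30 («Δ_a is a positive operator»)] -/
theorem eq_of_weak_DeltaA (hn : 1 ≤ n) (a : ℝ) (ha : 0 < a) {A₁ A₂ J : Tor (fine n M) × Fin d → ℂ}
    (h₁Q : QvOp n M *ᵥ A₁ = 0) (h₂Q : QvOp n M *ᵥ A₂ = 0)
    (h₁ : ∀ β, QvOp n M *ᵥ β = 0 → star β ⬝ᵥ (DeltaA n M a *ᵥ A₁) = star β ⬝ᵥ J)
    (h₂ : ∀ β, QvOp n M *ᵥ β = 0 → star β ⬝ᵥ (DeltaA n M a *ᵥ A₂) = star β ⬝ᵥ J) : A₁ = A₂ := by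
  by_contra hne
  have hD : A₁ - A₂ ≠ 0 := sub_ne_zero.mpr hne
  have hQD : QvOp n M *ᵥ (A₁ - A₂) = 0 := by rw [Matrix.mulVec_sub, h₁Q, h₂Q, sub_zero]
  have hpos := (DeltaA_posDef n hn M a ha).dotProduct_mulVec_pos hD
  rw [Matrix.mulVec_sub, dotProduct_sub, h₁ _ hQD, h₂ _ hQD, sub_self] at hpos
  exact lt_irrefl _ hpos

/-- **THE DOCKING (D5 (iv)+(v))**: if `α ∈ ker Q_k` solves the curl-only constrained weak equation `∀ β ∈ ker Q_k, ½⟨∂β, ∂α⟩ = ⟨β, J⟩` and `A ∈ ker Q_k` solves `Δ_a`'s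
`∀ β ∈ ker Q_k, ⟨β, Δ_aA⟩ = ⟨β, J⟩` (same `J`; `1 ≤ n`, `0 < a`), then `∂α = ∂A` — indeed `A` IS Bałaban's representative `α − ∂λ₀(∂ᴴα)`.
[cite: Balaban1984PropagatorsI, (1.25) p.22, (1.69)–(1.71) pp.29–30] -/
theorem CurlOp_eq_of_weak_curl_of_weak_DeltaA (hn : 1 ≤ n) (a : ℝ) (ha : 0 < a) {α A J : Tor (fine n M) × Fin d → ℂ}
    (hα : QvOp n M *ᵥ α = 0)
    (hw : ∀ β, QvOp n M *ᵥ β = 0 →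
      (1 / 2 : ℂ) * (star (CurlOp (fine n M) (n : ℂ) *ᵥ β) ⬝ᵥ (CurlOp (fine n M) (n : ℂ) *ᵥ α)) = star β ⬝ᵥ J)
    (hA : QvOp n M *ᵥ A = 0) (hAw : ∀ β, QvOp n M *ᵥ β = 0 → star β ⬝ᵥ (DeltaA n M a *ᵥ A) = star β ⬝ᵥ J) :
    gaugeT (fine n M) (n : ℂ) α (lambda0 n M (n : ℂ) ((GradOp (fine n M) (n : ℂ))ᴴ *ᵥ α)) = A
      ∧ CurlOp (fine n M) (n : ℂ) *ᵥ α = CurlOp (fine n M) (n : ℂ) *ᵥ A := by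
  obtain ⟨hQ, hC, hW⟩ := weak_DeltaA_gaugeT_lambda0 n M a hα hw
  have hEq := eq_of_weak_DeltaA n M hn a ha hQ hA hW hAw
  exact ⟨hEq, by rw [← hC, hEq]⟩

/-! ## §5 Units: the curl form at lattice factor `c` is `|c|²` × the form at `c = 1` -/

/-- `∂_c A = c·∂_1 A` on vectors (`Fs c = c ×` the unit differences). [cite: Balaban1984PropagatorsI, (1.2) p.18] -/
theorem CurlOp_mulVec_eq_smul (N : Fin d → ℕ) [∀ μ, NeZero (N μ)] (c : ℂ) (A : Tor N × Fin d → ℂ) :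
    CurlOp N c *ᵥ A = c • (CurlOp N 1 *ᵥ A) := by
  funext i
  obtain ⟨x, μ, ν⟩ := i
  rw [Pi.smul_apply, CurlOp_mulVec, CurlOp_mulVec, Fs_apply, Fs_apply, smul_eq_mul, one_mul]

/-- `⟨∂_c β, ∂_c α⟩ = (c̄c)·⟨∂_1 β, ∂_1 α⟩`. [folklore] -/
theorem curlForm_eq_mul (N : Fin d → ℕ) [∀ μ, NeZero (N μ)] (c : ℂ) (α β : Tor N × Fin d → ℂ) :
    star (CurlOp N c *ᵥ β) ⬝ᵥ (CurlOp N c *ᵥ α) = (conj c * c) * (star (CurlOp N 1 *ᵥ β) ⬝ᵥ (CurlOp N 1 *ᵥ α)) := by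
  rw [CurlOp_mulVec_eq_smul N c β, CurlOp_mulVec_eq_smul N c α, star_smul, smul_dotProduct, dotProduct_smul, smul_eq_mul, smul_eq_mul,
    Complex.star_def, mul_assoc]

/-- At `c = n = η⁻¹`: `⟨∂_n β, ∂_n α⟩ = n²·⟨∂_1 β, ∂_1 α⟩` — the unit of (145)'s reading of the T4 Hessian (`c = 1`) against `Δ_a`'s `c = n`. [folklore] -/
theorem curlForm_natCast (N : Fin d → ℕ) [∀ μ, NeZero (N μ)] (m : ℕ) (α β : Tor N × Fin d → ℂ) :
    star (CurlOp N (m : ℂ) *ᵥ β) ⬝ᵥ (CurlOp N (m : ℂ) *ᵥ α) = ((m : ℂ) ^ 2) * (star (CurlOp N 1 *ᵥ β) ⬝ᵥ (CurlOp N 1 *ᵥ α)) := by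
  rw [curlForm_eq_mul, map_natCast, sq]

/-! ## §6 Purely imaginary tests suffice (the transfers of SKEW T4 test fields) -/

/-- `Q_k` has real coefficients: it commutes with taking real parts entrywise. [cite: Balaban1984PropagatorsI, (1.18) p.20] -/
theorem QvOp_mulVec_re (β : Tor (fine n M) × Fin d → ℂ) (i : Tor M × Fin d) :
    (((QvOp n M *ᵥ β) i).re : ℂ) = (QvOp n M *ᵥ fun j => ((β j).re : ℂ)) i := by
  obtain ⟨y, μ⟩ := i
  rw [QvOp_mulVec, QvOp_mulVec]
  have hc : (1 / (n : ℂ) ^ (d + 1) : ℂ) = ((1 / (n : ℝ) ^ (d + 1) : ℝ) : ℂ) := by push_cast; rfl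
  rw [hc, Complex.re_ofReal_mul, Complex.ofReal_mul, Complex.re_sum, Complex.ofReal_sum]
  congr 1
  refine Finset.sum_congr rfl fun j _ => ?_
  simp only [B5Block118.lineSum, Complex.re_sum, Complex.ofReal_sum]

/-- **PURELY IMAGINARY TESTS SUFFICE**: if the curl-only identity `½⟨∂β, ∂α⟩ = ⟨β, J⟩` holds for every `β ∈ ker Q_k` with `conj β = −β` entrywise, it holds for every
`β ∈ ker Q_k` (both sides are conjugate-linear in `β`; `Q_k` is real, so `ker Q_k` is spanned by its imaginary elements `i·Re β`, `i·Im β`). [folklore] -/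
theorem weak_curl_of_imaginary_tests {α J : Tor (fine n M) × Fin d → ℂ} (c : ℂ)
    (hw : ∀ β, QvOp n M *ᵥ β = 0 → (∀ j, conj (β j) = -β j) →
      (1 / 2 : ℂ) * (star (CurlOp (fine n M) c *ᵥ β) ⬝ᵥ (CurlOp (fine n M) c *ᵥ α)) = star β ⬝ᵥ J)
    (β : Tor (fine n M) × Fin d → ℂ) (hβ : QvOp n M *ᵥ β = 0) :
    (1 / 2 : ℂ) * (star (CurlOp (fine n M) c *ᵥ β) ⬝ᵥ (CurlOp (fine n M) c *ᵥ α)) = star β ⬝ᵥ J := by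
  -- the identity is conjugate-linear in `β`: record it as a statement about `β`
  set Φ : (Tor (fine n M) × Fin d → ℂ) → Prop := fun β =>
    (1 / 2 : ℂ) * (star (CurlOp (fine n M) c *ᵥ β) ⬝ᵥ (CurlOp (fine n M) c *ᵥ α)) = star β ⬝ᵥ J with hΦ
  have hadd : ∀ β₁ β₂, Φ β₁ → Φ β₂ → Φ (β₁ + β₂) := fun β₁ β₂ h₁ h₂ => by
    simp only [hΦ] at h₁ h₂ ⊢
    rw [Matrix.mulVec_add, star_add, star_add, add_dotProduct, add_dotProduct, mul_add, h₁, h₂]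
  have hsmul : ∀ (z : ℂ) β₁, Φ β₁ → Φ (z • β₁) := fun z β₁ h₁ => by
    simp only [hΦ] at h₁ ⊢
    rw [Matrix.mulVec_smul, star_smul, star_smul, smul_dotProduct, smul_dotProduct, smul_eq_mul, smul_eq_mul, mul_left_comm, h₁]
  -- real and imaginary parts of `β` are in `ker Q_k`; `I • (real vector)` is imaginary
  set βr : Tor (fine n M) × Fin d → ℂ := fun j => ((β j).re : ℂ) with hβr
  set βi : Tor (fine n M) × Fin d → ℂ := fun j => ((β j).im : ℂ) with hβi
  have hQr : QvOp n M *ᵥ βr = 0 := by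
    funext i; rw [hβr, ← QvOp_mulVec_re, hβ]; simp
  have hQi : QvOp n M *ᵥ βi = 0 := by
    have hβ' : QvOp n M *ᵥ ((-Complex.I) • β) = 0 := by rw [Matrix.mulVec_smul, hβ, smul_zero]
    have h := fun i => QvOp_mulVec_re n M ((-Complex.I) • β) i
    funext i
    have hi := h i
    rw [hβ'] at hi
    simp only [Pi.zero_apply, Complex.zero_re, Complex.ofReal_zero, Pi.smul_apply, smul_eq_mul] at hi
    have hre : (fun j => (((-Complex.I) * β j).re : ℂ)) = βi := by
      funext j; rw [hβi]; simp
    rw [hre] at hi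
    rw [← hi, Pi.zero_apply]
  have hIr : Φ (Complex.I • βr) := by
    refine hw _ (by rw [Matrix.mulVec_smul, hQr, smul_zero]) fun j => ?_
    simp [hβr, Complex.conj_ofReal]
  have hIi : Φ (Complex.I • βi) := by
    refine hw _ (by rw [Matrix.mulVec_smul, hQi, smul_zero]) fun j => ?_
    simp [hβi, Complex.conj_ofReal]
  have hr : Φ βr := by
    have h := hsmul (-Complex.I) _ hIr
    rwa [smul_smul, show (-Complex.I) * Complex.I = 1 by rw [neg_mul, Complex.I_mul_I, neg_neg], one_smul] at h
  have hdec : β = βr + Complex.I • βi := by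
    funext j; simp only [Pi.add_apply, Pi.smul_apply, smul_eq_mul, hβr, hβi]; rw [mul_comm]; exact (Complex.re_add_im (β j)).symm
  have hfin : Φ (βr + Complex.I • βi) := hadd _ _ hr hIi
  rw [← hdec] at hfin
  simpa only [hΦ] using hfin

end

end Summit.QuantumFields.BalabanUV.T4Continuum.NE7StraightSliceB5Gauge
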